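import Summits.QuantumFields.YangMills.Theorems.ColdStartUniversalityLatticeLangevinGroundStateGen
import Summits.QuantumFields.YangMills.Theorems.ColdStartUniversalityLatticeLangevinDynkinSeparable
import HarnessLib

/-!
# Route `ColdStartUniversality`, crux K_A1 `UniformColdStartMixing` (stmt-QuantumFields-24809), rung `stub_fixedCutoffMixing`:
# G-block, assembly A2b — the ground-state supersolution inequality

Helper file (seat `ym-line-csu-p1`, g7).  For the SU(2) SZZ system at coupling `β'` (solution family `X` with the regular-flow
clause), a `β' = 0` solution family `Y` (same clause, any space), a finite sum `F = Σ_l c_l ∏_e U_{m_{l,e}}(⟨ρ g_{l,e}, ρ ·⟩/2)` of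
latitude eigenfunctions which is `≥ 0` on the group, and `K` bounding the ground-state potential `V̂` on the group:

  `φ̂(x) · E F(Y^x_t) ≤ e^{Kt} · E[φ̂(X^x_t) F(X^x_t)]`,   `φ̂ = exp(-ψ̂/2)`  (`groundState_supersolution`).

Proof: the time-dependent Dynkin formula (`dynkin_separable`) for `u(s,·) = e^{Ks} φ̂ Σ_l c_l e^{-λ_l(t-s)} F̂_l` (cut off), whose
`(∂_s + 𝓛_{β'})`-image at group points is `(K - V̂) e^{Ks} φ̂ · E F(Y^·_{t-s}) ≥ 0` (`generator_groundState_ridge`,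
`integral_prod_gegenbauer_latitude`).  No definition, no sorry.  RECORD-rung R3 plumbing; nothing here bears on the mass gap.
-/

set_option autoImplicit false

noncomputable section

namespace Summit.QuantumFields.YangMills.Theorems.ColdStartUniversality

open MeasureTheory Finset Metric Filter
open scoped BigOperators Topology NNReal
open Literature.Probability.Process Literature.MathematicalPhysics.QuantumFieldTheory Literature.Analysis.SpecialFunctions
open Literature.MathematicalPhysics.QuantumLattice (fundamentalRep fundamentalLatticeRep)

variable {L : ℕ} [NeZero L]

/-- **Ground-state supersolution inequality.**  See the module docstring. [folklore] -/
theorem groundState_supersolution (β' : ℝ)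
    {Ω : Type} [MeasurableSpace Ω] {P : Measure Ω} [IsProbabilityMeasure P]
    {W : ℝ≥0 → Ω → (Edge 3 L × NoiseIdx 2 → ℝ)} (hW : IsFlatBrownian W P)
    (U : GaugeConfig 3 L (Matrix.specialUnitaryGroup (Fin 2) ℂ) → ℝ≥0 → Ω →
      GaugeConfig 3 L (Matrix.specialUnitaryGroup (Fin 2) ℂ))
    (hU : ∀ x, (∀ ω, U x 0 ω = x) ∧
      (latticeLangevinDynamics (fundamentalLatticeRep 2) β').IsSolution (fundamentalRep (Fin 2))
        hW.natFiltration P W (U x))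
    (hUm : ∀ i : ℝ≥0, Measurable[@Prod.instMeasurableSpace (Set.Iic i)
        (GaugeConfig 3 L (Matrix.specialUnitaryGroup (Fin 2) ℂ) × Ω) inferInstance
        (@Prod.instMeasurableSpace (GaugeConfig 3 L (Matrix.specialUnitaryGroup (Fin 2) ℂ)) Ω inferInstance
          (hW.natFiltration i))]
      (fun q : Set.Iic i × (GaugeConfig 3 L (Matrix.specialUnitaryGroup (Fin 2) ℂ) × Ω) => U q.2.1 q.1 q.2.2))
    {Ω' : Type} [MeasurableSpace Ω'] {P' : Measure Ω'} [IsProbabilityMeasure P']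
    {W' : ℝ≥0 → Ω' → (Edge 3 L × NoiseIdx 2 → ℝ)} (hW' : IsFlatBrownian W' P')
    (Y : GaugeConfig 3 L (Matrix.specialUnitaryGroup (Fin 2) ℂ) → ℝ≥0 → Ω' →
      GaugeConfig 3 L (Matrix.specialUnitaryGroup (Fin 2) ℂ))
    (hY : ∀ x, (∀ ω, Y x 0 ω = x) ∧
      (latticeLangevinDynamics (fundamentalLatticeRep 2) 0).IsSolution (fundamentalRep (Fin 2))
        hW'.natFiltration P' W' (Y x))
    (hYm : ∀ i : ℝ≥0, Measurable[@Prod.instMeasurableSpace (Set.Iic i)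
        (GaugeConfig 3 L (Matrix.specialUnitaryGroup (Fin 2) ℂ) × Ω') inferInstance
        (@Prod.instMeasurableSpace (GaugeConfig 3 L (Matrix.specialUnitaryGroup (Fin 2) ℂ)) Ω' inferInstance
          (hW'.natFiltration i))]
      (fun q : Set.Iic i × (GaugeConfig 3 L (Matrix.specialUnitaryGroup (Fin 2) ℂ) × Ω') => Y q.2.1 q.1 q.2.2))
    {κ : Type} [Fintype κ] (c : κ → ℝ) (g : κ → Edge 3 L → Matrix.specialUnitaryGroup (Fin 2) ℂ) (m : κ → Edge 3 L → ℕ)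
    (hF : ∀ V : GaugeConfig 3 L (Matrix.specialUnitaryGroup (Fin 2) ℂ),
      0 ≤ ∑ l, c l * ∏ e, gegenbauerSum 1 (m l e) (hsForm 2 (fundamentalRep (Fin 2) (g l e)) (fundamentalRep (Fin 2) (V e)) / 2))
    (K : ℝ)
    (hK : ∀ V : GaugeConfig 3 L (Matrix.specialUnitaryGroup (Fin 2) ℂ),
      let x : (Edge 3 L × Fin 2 × Fin 2 × Bool) → ℝ := fun q =>
        (fun z : ℂ => if q.2.2.2 then z.im else z.re)
          ((fundamentalRep (Fin 2) (V q.1) : Matrix (Fin 2) (Fin 2) ℂ) q.2.1 q.2.2.1)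
      let b₀ : (Edge 3 L × Fin 2 × Fin 2 × Bool) → ℝ := fun q =>
        (fun z : ℂ => if q.2.2.2 then z.im else z.re) ((latticeLangevinDynamics (fundamentalLatticeRep 2) 0).drift
          (matrixConfig (fundamentalRep (Fin 2)) V) q.1 q.2.1 q.2.2.1)
      let σ : (Edge 3 L × Fin 2 × Fin 2 × Bool) → (Edge 3 L × NoiseIdx 2) → ℝ := fun q k =>
        if k.1 = q.1 then (fun z : ℂ => if q.2.2.2 then z.im else z.re)
          ((latticeLangevinDynamics (fundamentalLatticeRep 2) 0).noise
            (matrixConfig (fundamentalRep (Fin 2)) V) q.1 k.2 q.2.1 q.2.2.1) else 0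
      let ψ : ((Edge 3 L × Fin 2 × Fin 2 × Bool) → ℝ) → ℝ := fun y =>
        β' * ∑ p : Plaquette 3 L, (rootedLoop (fun (e : Edge 3 L) (i j : Fin 2) =>
          ((y (e, i, j, false) : ℝ) : ℂ) + ((y (e, i, j, true) : ℝ) : ℂ) * Complex.I) (p.1, p.2.1.1) p.2.1.2 false).trace.re
      1 / 2 * (∑ i, fderiv ℝ ψ x (Pi.single i 1) * b₀ i +
          1 / 2 * ∑ i, ∑ j, fderiv ℝ (fun z => fderiv ℝ ψ z (Pi.single i 1)) x (Pi.single j 1) * ∑ n, σ i n * σ j n) +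
        1 / 8 * ∑ i, ∑ j, fderiv ℝ ψ x (Pi.single i 1) * fderiv ℝ ψ x (Pi.single j 1) * ∑ n, σ i n * σ j n ≤ K)
    (x : GaugeConfig 3 L (Matrix.specialUnitaryGroup (Fin 2) ℂ)) (t : ℝ≥0) :
    let ψV : GaugeConfig 3 L (Matrix.specialUnitaryGroup (Fin 2) ℂ) → ℝ := fun V =>
      β' * ∑ p : Plaquette 3 L, (rootedLoop (fun (e : Edge 3 L) (i j : Fin 2) =>
        ((((fundamentalRep (Fin 2) (V e) : Matrix (Fin 2) (Fin 2) ℂ) i j).re : ℝ) : ℂ) +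
          ((((fundamentalRep (Fin 2) (V e) : Matrix (Fin 2) (Fin 2) ℂ) i j).im : ℝ) : ℂ) * Complex.I)
        (p.1, p.2.1.1) p.2.1.2 false).trace.re
    Real.exp (-(1 / 2 : ℝ) * ψV x) *
        ∫ ω', (∑ l, c l * ∏ e, gegenbauerSum 1 (m l e)
          (hsForm 2 (fundamentalRep (Fin 2) (g l e)) (fundamentalRep (Fin 2) (Y x t ω' e)) / 2)) ∂P' ≤
      Real.exp (K * t) * ∫ ω, Real.exp (-(1 / 2 : ℝ) * ψV (U x t ω)) *
        (∑ l, c l * ∏ e, gegenbauerSum 1 (m l e)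
          (hsForm 2 (fundamentalRep (Fin 2) (g l e)) (fundamentalRep (Fin 2) (U x t ω e)) / 2)) ∂P := by
  intro ψV
  classical
  haveI := secondCountableTopology_su2
  haveI := borelSpace_config L
  -- ### the objects in flat coordinates
  set ψ : ((Edge 3 L × Fin 2 × Fin 2 × Bool) → ℝ) → ℝ := fun y =>
      β' * ∑ p : Plaquette 3 L, (rootedLoop (fun (e : Edge 3 L) (i j : Fin 2) =>
        ((y (e, i, j, false) : ℝ) : ℂ) + ((y (e, i, j, true) : ℝ) : ℂ) * Complex.I) (p.1, p.2.1.1) p.2.1.2 false).trace.re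
    with hψdef
  set Fh : κ → ((Edge 3 L × Fin 2 × Fin 2 × Bool) → ℝ) → ℝ := fun l y => ∏ e, gegenbauerSum 1 (m l e)
      ((∑ i, ∑ j, (((fundamentalRep (Fin 2) (g l e) : Matrix (Fin 2) (Fin 2) ℂ) i j).re * y (e, i, j, false) +
        ((fundamentalRep (Fin 2) (g l e) : Matrix (Fin 2) (Fin 2) ℂ) i j).im * y (e, i, j, true))) / 2) with hFhdef
  let χ : ContDiffBump (0 : (Edge 3 L × Fin 2 × Fin 2 × Bool) → ℝ) := ⟨2, 3, by norm_num, by norm_num⟩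
  have hχ : (2 : ℝ) ≤ χ.rIn := le_rfl
  set f : κ → ((Edge 3 L × Fin 2 × Fin 2 × Bool) → ℝ) → ℝ := fun l y =>
      (χ : ((Edge 3 L × Fin 2 × Fin 2 × Bool) → ℝ) → ℝ) y * (Real.exp (-(1 / 2 : ℝ) * ψ y) * Fh l y) with hfdef
  set lam : κ → ℝ := fun l => ∑ e, (m l e : ℝ) * ((m l e : ℝ) + 2) / 2 with hlamdef
  set a : κ → ℝ → ℝ := fun l s => c l * Real.exp (K * s - lam l * ((t : ℝ) - s)) with hadef
  set a' : κ → ℝ → ℝ := fun l s => (K + lam l) * a l s with ha'def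
  -- values at group points
  have hcoords_ball : ∀ V : GaugeConfig 3 L (Matrix.specialUnitaryGroup (Fin 2) ℂ),
      (fun q : Edge 3 L × Fin 2 × Fin 2 × Bool => (fun z : ℂ => if q.2.2.2 then z.im else z.re)
        ((fundamentalRep (Fin 2) (V q.1) : Matrix (Fin 2) (Fin 2) ℂ) q.2.1 q.2.2.1)) ∈
        closedBall (0 : (Edge 3 L × Fin 2 × Fin 2 × Bool) → ℝ) χ.rIn := by
    intro V
    rw [mem_closedBall, dist_zero_right]
    exact (norm_coords_le_one V).trans (by norm_num : (1 : ℝ) ≤ 2)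
  have hψV : ∀ V : GaugeConfig 3 L (Matrix.specialUnitaryGroup (Fin 2) ℂ), ψV V =
      ψ (fun q : Edge 3 L × Fin 2 × Fin 2 × Bool => (fun z : ℂ => if q.2.2.2 then z.im else z.re)
        ((fundamentalRep (Fin 2) (V q.1) : Matrix (Fin 2) (Fin 2) ℂ) q.2.1 q.2.2.1)) := fun V => rfl
  have hFhV : ∀ (l : κ) (V : GaugeConfig 3 L (Matrix.specialUnitaryGroup (Fin 2) ℂ)),
      Fh l (fun q : Edge 3 L × Fin 2 × Fin 2 × Bool => (fun z : ℂ => if q.2.2.2 then z.im else z.re)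
        ((fundamentalRep (Fin 2) (V q.1) : Matrix (Fin 2) (Fin 2) ℂ) q.2.1 q.2.2.1)) =
      ∏ e, gegenbauerSum 1 (m l e) (hsForm 2 (fundamentalRep (Fin 2) (g l e)) (fundamentalRep (Fin 2) (V e)) / 2) := by
    intro l V
    rw [hFhdef]
    have h := fun e => latitude_coords (fun e => (fundamentalRep (Fin 2) (g l e) : Matrix (Fin 2) (Fin 2) ℂ))
      (fun e => (fundamentalRep (Fin 2) (V e) : Matrix (Fin 2) (Fin 2) ℂ)) e
    simp only [Bool.false_eq_true, ↓reduceIte] at h ⊢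
    exact Finset.prod_congr rfl fun e _ => by rw [h e]
  have hfval : ∀ (l : κ) (V : GaugeConfig 3 L (Matrix.specialUnitaryGroup (Fin 2) ℂ)),
      f l (fun q : Edge 3 L × Fin 2 × Fin 2 × Bool => (fun z : ℂ => if q.2.2.2 then z.im else z.re)
        ((fundamentalRep (Fin 2) (V q.1) : Matrix (Fin 2) (Fin 2) ℂ) q.2.1 q.2.2.1)) =
      Real.exp (-(1 / 2 : ℝ) * ψV V) *
        ∏ e, gegenbauerSum 1 (m l e) (hsForm 2 (fundamentalRep (Fin 2) (g l e)) (fundamentalRep (Fin 2) (V e)) / 2) := by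
    intro l V
    simp only [hfdef]
    rw [χ.one_of_mem_closedBall (hcoords_ball V), one_mul, hFhV, hψV]
  -- ### the semigroup identity at `β' = 0` and positivity
  have hmeasY : ∀ V (τ : ℝ≥0), Measurable (Y V τ) := fun V τ =>
    ((hY V).2.adapted τ).mono (hW'.natFiltration.le τ) le_rfl
  have hT : ∀ (V : GaugeConfig 3 L (Matrix.specialUnitaryGroup (Fin 2) ℂ)) (τ : ℝ≥0),
      ∑ l, c l * Real.exp (-(lam l) * τ) *
          ∏ e, gegenbauerSum 1 (m l e) (hsForm 2 (fundamentalRep (Fin 2) (g l e)) (fundamentalRep (Fin 2) (V e)) / 2) =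
        ∫ ω', (∑ l, c l * ∏ e, gegenbauerSum 1 (m l e)
          (hsForm 2 (fundamentalRep (Fin 2) (g l e)) (fundamentalRep (Fin 2) (Y V τ ω' e)) / 2)) ∂P' := by
    intro V τ
    have hint : ∀ l, Integrable (fun ω' => ∏ e, gegenbauerSum 1 (m l e)
        (hsForm 2 (fundamentalRep (Fin 2) (g l e)) (fundamentalRep (Fin 2) (Y V τ ω' e)) / 2)) P' := by
      intro l
      have hc := continuous_prod_gegenbauer_latitude (L := L) (g l) (m l)
      obtain ⟨M, -, hM⟩ := exists_abs_le_of_continuous hc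
      exact Integrable.of_bound (hc.measurable.comp (hmeasY V τ)).aestronglyMeasurable M
        (Eventually.of_forall fun ω' => by rw [Real.norm_eq_abs]; exact hM _)
    rw [integral_finsetSum _ fun l _ => (hint l).const_mul _]
    refine Finset.sum_congr rfl fun l _ => ?_
    rw [MeasureTheory.integral_const_mul, integral_prod_gegenbauer_latitude hW' Y hY hYm V (g l) (m l) τ, hlamdef]
    ring
  have hTnonneg : ∀ (V : GaugeConfig 3 L (Matrix.specialUnitaryGroup (Fin 2) ℂ)) (τ : ℝ≥0),
      0 ≤ ∑ l, c l * Real.exp (-(lam l) * τ) *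
          ∏ e, gegenbauerSum 1 (m l e) (hsForm 2 (fundamentalRep (Fin 2) (g l e)) (fundamentalRep (Fin 2) (V e)) / 2) := by
    intro V τ; rw [hT V τ]; exact integral_nonneg fun ω' => hF _
  -- ### the generator at group points
  have hgen : ∀ (l : κ) (V : GaugeConfig 3 L (Matrix.specialUnitaryGroup (Fin 2) ℂ)),
      (∑ i : Edge 3 L × Fin 2 × Fin 2 × Bool, fderiv ℝ (f l)
          (fun q : Edge 3 L × Fin 2 × Fin 2 × Bool => (fun z : ℂ => if q.2.2.2 then z.im else z.re)
            ((fundamentalRep (Fin 2) (V q.1) : Matrix (Fin 2) (Fin 2) ℂ) q.2.1 q.2.2.1)) (Pi.single i 1) *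
          (fun z : ℂ => if i.2.2.2 then z.im else z.re)
            ((latticeLangevinDynamics (fundamentalLatticeRep 2) β').drift
              (matrixConfig (fundamentalRep (Fin 2)) V) i.1 i.2.1 i.2.2.1) +
      1 / 2 * ∑ i : Edge 3 L × Fin 2 × Fin 2 × Bool, ∑ j : Edge 3 L × Fin 2 × Fin 2 × Bool,
        fderiv ℝ (fun z => fderiv ℝ (f l) z (Pi.single i 1))
            (fun q : Edge 3 L × Fin 2 × Fin 2 × Bool => (fun z : ℂ => if q.2.2.2 then z.im else z.re)
              ((fundamentalRep (Fin 2) (V q.1) : Matrix (Fin 2) (Fin 2) ℂ) q.2.1 q.2.2.1)) (Pi.single j 1) *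
          ∑ n : Edge 3 L × NoiseIdx 2,
            (if n.1 = i.1 then (fun z : ℂ => if i.2.2.2 then z.im else z.re)
              ((latticeLangevinDynamics (fundamentalLatticeRep 2) β').noise
                (matrixConfig (fundamentalRep (Fin 2)) V) i.1 n.2 i.2.1 i.2.2.1) else 0) *
            (if n.1 = j.1 then (fun z : ℂ => if j.2.2.2 then z.im else z.re)
              ((latticeLangevinDynamics (fundamentalLatticeRep 2) β').noise
                (matrixConfig (fundamentalRep (Fin 2)) V) j.1 n.2 j.2.1 j.2.2.1) else 0)) =
      Real.exp (-(1 / 2 : ℝ) * ψV V) * ((-(lam l)) *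
          ∏ e, gegenbauerSum 1 (m l e) (hsForm 2 (fundamentalRep (Fin 2) (g l e)) (fundamentalRep (Fin 2) (V e)) / 2) -
        (let x : (Edge 3 L × Fin 2 × Fin 2 × Bool) → ℝ := fun q =>
            (fun z : ℂ => if q.2.2.2 then z.im else z.re)
              ((fundamentalRep (Fin 2) (V q.1) : Matrix (Fin 2) (Fin 2) ℂ) q.2.1 q.2.2.1)
          let b₀ : (Edge 3 L × Fin 2 × Fin 2 × Bool) → ℝ := fun q =>
            (fun z : ℂ => if q.2.2.2 then z.im else z.re) ((latticeLangevinDynamics (fundamentalLatticeRep 2) 0).drift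
              (matrixConfig (fundamentalRep (Fin 2)) V) q.1 q.2.1 q.2.2.1)
          let σ : (Edge 3 L × Fin 2 × Fin 2 × Bool) → (Edge 3 L × NoiseIdx 2) → ℝ := fun q k =>
            if k.1 = q.1 then (fun z : ℂ => if q.2.2.2 then z.im else z.re)
              ((latticeLangevinDynamics (fundamentalLatticeRep 2) 0).noise
                (matrixConfig (fundamentalRep (Fin 2)) V) q.1 k.2 q.2.1 q.2.2.1) else 0
          1 / 2 * (∑ i, fderiv ℝ ψ x (Pi.single i 1) * b₀ i +
              1 / 2 * ∑ i, ∑ j, fderiv ℝ (fun z => fderiv ℝ ψ z (Pi.single i 1)) x (Pi.single j 1) * ∑ n, σ i n * σ j n) +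
            1 / 8 * ∑ i, ∑ j, fderiv ℝ ψ x (Pi.single i 1) * fderiv ℝ ψ x (Pi.single j 1) * ∑ n, σ i n * σ j n) *
          ∏ e, gegenbauerSum 1 (m l e) (hsForm 2 (fundamentalRep (Fin 2) (g l e)) (fundamentalRep (Fin 2) (V e)) / 2)) := by
    intro l V
    have h := generator_groundState_ridge (L := L) β' (g l) V (m l) χ hχ
    dsimp only at h
    rw [hψV, ← hFhV l V]
    exact h
  -- ### smoothness, compact support, the time coefficients
  have hψ3 : ContDiff ℝ 3 ψ := contDiff_psiHat (d := 3) (L := L) (N := 2) (n := 3) β'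
  have hFh3 : ∀ l, ContDiff ℝ 3 (Fh l) := by
    intro l
    obtain ⟨ℓ, hℓ⟩ := latitude_eq_clm (L := L) (fun e => (fundamentalRep (Fin 2) (g l e) : Matrix (Fin 2) (Fin 2) ℂ))
    have hΦ : ContDiff ℝ 3 (fun s : Edge 3 L → ℝ => ∏ e, gegenbauerSum 1 (m l e) (s e)) :=
      contDiff_prod (fun e _ => (contDiff_gegenbauerSum 1 (m l e)).comp (contDiff_apply ℝ ℝ e))
    have heq : Fh l = fun y => (fun s : Edge 3 L → ℝ => ∏ e, gegenbauerSum 1 (m l e) (s e)) (ℓ y) := by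
      funext y; simp only [hFhdef, hℓ]
    rw [heq]; exact hΦ.comp ℓ.contDiff
  have hf3 : ∀ l, ContDiff ℝ 3 (f l) := fun l =>
    (χ.contDiff (n := 3)).mul ((Real.contDiff_exp.comp (contDiff_const.mul hψ3)).mul (hFh3 l))
  have hfc : ∀ l, HasCompactSupport (f l) := fun l => by
    rw [hfdef]; exact χ.hasCompactSupport.mul_right
  have hader : ∀ l r, HasDerivAt (a l) (a' l r) r := by
    intro l r
    have h1 : HasDerivAt (fun s : ℝ => K * s - lam l * ((t : ℝ) - s)) (K + lam l) r := by
      have h := ((hasDerivAt_id r).const_mul K).sub (((hasDerivAt_id r).const_sub (t : ℝ)).const_mul (lam l))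
      exact h.congr_deriv (by simp)
    have h2 := (h1.exp).const_mul (c l)
    refine h2.congr_deriv ?_
    simp only [ha'def, hadef]; ring
  have ha'c : ∀ l, Continuous (a' l) := fun l => by
    simp only [ha'def, hadef]
    exact continuous_const.mul (continuous_const.mul (Real.continuous_exp.comp
      ((continuous_const.mul continuous_id).sub (continuous_const.mul (continuous_const.sub continuous_id)))))
  -- ### the time-dependent Dynkin formula
  have hD := dynkin_separable (L := L) β' hW U hU hUm x hf3 hfc hader ha'c (t := (t : ℝ)) t.2
  dsimp only at hD
  have htt : ((t : ℝ)).toNNReal = t := Real.toNNReal_coe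
  -- the three pieces
  have hmeasU : ∀ τ : ℝ≥0, Measurable (U x τ) := fun τ => ((hU x).2.adapted τ).mono (hW.natFiltration.le τ) le_rfl
  have hL : ∫ ω, ∑ l, a l (t : ℝ) * f l (fun q : Edge 3 L × Fin 2 × Fin 2 × Bool =>
      (fun z : ℂ => if q.2.2.2 then z.im else z.re)
        ((fundamentalRep (Fin 2) (U x ((t : ℝ)).toNNReal ω q.1) : Matrix (Fin 2) (Fin 2) ℂ) q.2.1 q.2.2.1)) ∂P =
      Real.exp (K * t) * ∫ ω, Real.exp (-(1 / 2 : ℝ) * ψV (U x t ω)) *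
        (∑ l, c l * ∏ e, gegenbauerSum 1 (m l e)
          (hsForm 2 (fundamentalRep (Fin 2) (g l e)) (fundamentalRep (Fin 2) (U x t ω e)) / 2)) ∂P := by
    rw [htt, ← MeasureTheory.integral_const_mul]
    refine integral_congr_ae (Eventually.of_forall fun ω => ?_)
    simp only [hfval, hadef, sub_self, mul_zero, sub_zero, Finset.mul_sum]
    exact Finset.sum_congr rfl fun l _ => by ring
  have h0 : ∑ l, a l 0 * f l (fun q : Edge 3 L × Fin 2 × Fin 2 × Bool =>
      (fun z : ℂ => if q.2.2.2 then z.im else z.re)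
        ((fundamentalRep (Fin 2) (x q.1) : Matrix (Fin 2) (Fin 2) ℂ) q.2.1 q.2.2.1)) =
      Real.exp (-(1 / 2 : ℝ) * ψV x) *
        ∫ ω', (∑ l, c l * ∏ e, gegenbauerSum 1 (m l e)
          (hsForm 2 (fundamentalRep (Fin 2) (g l e)) (fundamentalRep (Fin 2) (Y x t ω' e)) / 2)) ∂P' := by
    rw [← hT x t, Finset.mul_sum]
    refine Finset.sum_congr rfl fun l _ => ?_
    simp only [hfval, hadef, mul_zero, zero_sub, sub_zero]
    rw [show -(lam l * (t : ℝ)) = -lam l * (t : ℝ) by ring]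
    ring
  have hpos : 0 ≤ ∫ r in (0 : ℝ)..(t : ℝ), ∫ ω, ∑ l, (a' l r * f l (fun q : Edge 3 L × Fin 2 × Fin 2 × Bool =>
      (fun z : ℂ => if q.2.2.2 then z.im else z.re)
        ((fundamentalRep (Fin 2) (U x r.toNNReal ω q.1) : Matrix (Fin 2) (Fin 2) ℂ) q.2.1 q.2.2.1)) +
      a l r * (∑ i : Edge 3 L × Fin 2 × Fin 2 × Bool, fderiv ℝ (f l)
          (fun q : Edge 3 L × Fin 2 × Fin 2 × Bool => (fun z : ℂ => if q.2.2.2 then z.im else z.re)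
            ((fundamentalRep (Fin 2) (U x r.toNNReal ω q.1) : Matrix (Fin 2) (Fin 2) ℂ) q.2.1 q.2.2.1)) (Pi.single i 1) *
          (fun z : ℂ => if i.2.2.2 then z.im else z.re)
            ((latticeLangevinDynamics (fundamentalLatticeRep 2) β').drift
              (matrixConfig (fundamentalRep (Fin 2)) (U x r.toNNReal ω)) i.1 i.2.1 i.2.2.1) +
      1 / 2 * ∑ i : Edge 3 L × Fin 2 × Fin 2 × Bool, ∑ j : Edge 3 L × Fin 2 × Fin 2 × Bool,
        fderiv ℝ (fun z => fderiv ℝ (f l) z (Pi.single i 1))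
            (fun q : Edge 3 L × Fin 2 × Fin 2 × Bool => (fun z : ℂ => if q.2.2.2 then z.im else z.re)
              ((fundamentalRep (Fin 2) (U x r.toNNReal ω q.1) : Matrix (Fin 2) (Fin 2) ℂ) q.2.1 q.2.2.1)) (Pi.single j 1) *
          ∑ n : Edge 3 L × NoiseIdx 2,
            (if n.1 = i.1 then (fun z : ℂ => if i.2.2.2 then z.im else z.re)
              ((latticeLangevinDynamics (fundamentalLatticeRep 2) β').noise
                (matrixConfig (fundamentalRep (Fin 2)) (U x r.toNNReal ω)) i.1 n.2 i.2.1 i.2.2.1) else 0) *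
            (if n.1 = j.1 then (fun z : ℂ => if j.2.2.2 then z.im else z.re)
              ((latticeLangevinDynamics (fundamentalLatticeRep 2) β').noise
                (matrixConfig (fundamentalRep (Fin 2)) (U x r.toNNReal ω)) j.1 n.2 j.2.1 j.2.2.1) else 0))) ∂P := by
    refine intervalIntegral.integral_nonneg t.2 fun r hr => integral_nonneg fun ω => ?_
    simp only [Pi.zero_apply]
    set V := U x r.toNNReal ω with hV
    -- rewrite each term at the group point `V`
    have hterm : ∀ l, a' l r * f l (fun q : Edge 3 L × Fin 2 × Fin 2 × Bool =>
        (fun z : ℂ => if q.2.2.2 then z.im else z.re)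
          ((fundamentalRep (Fin 2) (V q.1) : Matrix (Fin 2) (Fin 2) ℂ) q.2.1 q.2.2.1)) +
        a l r * (∑ i : Edge 3 L × Fin 2 × Fin 2 × Bool, fderiv ℝ (f l)
          (fun q : Edge 3 L × Fin 2 × Fin 2 × Bool => (fun z : ℂ => if q.2.2.2 then z.im else z.re)
            ((fundamentalRep (Fin 2) (V q.1) : Matrix (Fin 2) (Fin 2) ℂ) q.2.1 q.2.2.1)) (Pi.single i 1) *
          (fun z : ℂ => if i.2.2.2 then z.im else z.re)
            ((latticeLangevinDynamics (fundamentalLatticeRep 2) β').drift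
              (matrixConfig (fundamentalRep (Fin 2)) V) i.1 i.2.1 i.2.2.1) +
        1 / 2 * ∑ i : Edge 3 L × Fin 2 × Fin 2 × Bool, ∑ j : Edge 3 L × Fin 2 × Fin 2 × Bool,
          fderiv ℝ (fun z => fderiv ℝ (f l) z (Pi.single i 1))
            (fun q : Edge 3 L × Fin 2 × Fin 2 × Bool => (fun z : ℂ => if q.2.2.2 then z.im else z.re)
              ((fundamentalRep (Fin 2) (V q.1) : Matrix (Fin 2) (Fin 2) ℂ) q.2.1 q.2.2.1)) (Pi.single j 1) *
          ∑ n : Edge 3 L × NoiseIdx 2,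
            (if n.1 = i.1 then (fun z : ℂ => if i.2.2.2 then z.im else z.re)
              ((latticeLangevinDynamics (fundamentalLatticeRep 2) β').noise
                (matrixConfig (fundamentalRep (Fin 2)) V) i.1 n.2 i.2.1 i.2.2.1) else 0) *
            (if n.1 = j.1 then (fun z : ℂ => if j.2.2.2 then z.im else z.re)
              ((latticeLangevinDynamics (fundamentalLatticeRep 2) β').noise
                (matrixConfig (fundamentalRep (Fin 2)) V) j.1 n.2 j.2.1 j.2.2.1) else 0)) =
        (Real.exp (K * r) * (c l * Real.exp (-(lam l) * (((t : ℝ) - r).toNNReal : ℝ)) *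
          ∏ e, gegenbauerSum 1 (m l e) (hsForm 2 (fundamentalRep (Fin 2) (g l e)) (fundamentalRep (Fin 2) (V e)) / 2))) *
          (Real.exp (-(1 / 2 : ℝ) * ψV V) * (K -
          (let x : (Edge 3 L × Fin 2 × Fin 2 × Bool) → ℝ := fun q =>
              (fun z : ℂ => if q.2.2.2 then z.im else z.re)
                ((fundamentalRep (Fin 2) (V q.1) : Matrix (Fin 2) (Fin 2) ℂ) q.2.1 q.2.2.1)
           let b₀ : (Edge 3 L × Fin 2 × Fin 2 × Bool) → ℝ := fun q =>
              (fun z : ℂ => if q.2.2.2 then z.im else z.re) ((latticeLangevinDynamics (fundamentalLatticeRep 2) 0).drift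
                (matrixConfig (fundamentalRep (Fin 2)) V) q.1 q.2.1 q.2.2.1)
           let σ : (Edge 3 L × Fin 2 × Fin 2 × Bool) → (Edge 3 L × NoiseIdx 2) → ℝ := fun q k =>
              if k.1 = q.1 then (fun z : ℂ => if q.2.2.2 then z.im else z.re)
                ((latticeLangevinDynamics (fundamentalLatticeRep 2) 0).noise
                  (matrixConfig (fundamentalRep (Fin 2)) V) q.1 k.2 q.2.1 q.2.2.1) else 0
           1 / 2 * (∑ i, fderiv ℝ ψ x (Pi.single i 1) * b₀ i +
               1 / 2 * ∑ i, ∑ j, fderiv ℝ (fun z => fderiv ℝ ψ z (Pi.single i 1)) x (Pi.single j 1) * ∑ n, σ i n * σ j n) +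
             1 / 8 * ∑ i, ∑ j, fderiv ℝ ψ x (Pi.single i 1) * fderiv ℝ ψ x (Pi.single j 1) * ∑ n, σ i n * σ j n))) := by
      intro l
      rw [hfval, hgen]
      dsimp only
      have hr1 : ((((t : ℝ) - r).toNNReal : ℝ≥0) : ℝ) = (t : ℝ) - r := Real.coe_toNNReal _ (by linarith [hr.2])
      rw [hr1]
      simp only [ha'def, hadef]
      rw [show K * r - lam l * ((t : ℝ) - r) = K * r + (-(lam l) * ((t : ℝ) - r)) by ring, Real.exp_add]
      ring
    simp only [hterm]
    rw [← Finset.sum_mul]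
    refine mul_nonneg (by
      rw [← Finset.mul_sum]
      exact mul_nonneg (Real.exp_pos _).le (hTnonneg V _)) (mul_nonneg (Real.exp_pos _).le ?_)
    have hKV := hK V
    dsimp only at hKV
    linarith
  rw [hL, h0] at hD
  linarith [hpos]

end Summit.QuantumFields.YangMills.Theorems.ColdStartUniversality

end
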